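import Literature.Geometry.Symplectic.LefschetzBaseLevi
import Literature.Geometry.Symplectic.LefschetzBaseSteinModel
import Literature.Topology.FourManifolds.LefschetzBaseModelIdentification
import HarnessLib

/-!
# The rounded convex model of the Lefschetz base is a Stein domain for the standard `J₀`

Topic `Literature/Geometry/Symplectic`; continuation of `LefschetzBaseLevi.lean` towards the
handle-free base case of `Literature.Geometry.Symplectic.palf_stein_supportedByBoundaryOpenBook`
(in the form `palf_stein_supportedByBoundaryOpenBook_of_reebModels`,
`LefschetzSteinOpenBookReeb.lean`;
Torisu 2000 / Akbulut–Ozbagci 2001, proof of Thm. 5, first step: "`X₀ = D² × F` is Stein").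
Everything is **proved**; the three definitions (`yMass`, `yMassLevi`, `qPert`) are explicit
auxiliary functions; no named fact.

The model.  `LefschetzBaseModelIdentification.lean` carries the base `Base g = {rho g ≤ 1/4}`
onto `{Ψ ≤ 1/4}`, `Ψ = modelFun g ε q = ‖w‖² + Θ(‖x‖²) + ε q`, for any smooth `q ≥ 0` and small
`ε`, by a page-preserving diffeomorphism of `ℂ²`.  Here the perturbation is fixed to
**`q_δ = ‖x‖² + δ m(‖y‖²)`, `m(t) = χ(t) t`** (`χ = yCutoff`: `m(t) = t` for `t ≤ 3/20`, `m = 0`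
for `t ≥ 3/10`), and:

* §1 `yMass = m`, its Levi coefficient `yMassLevi = m' + t m''` (`= 1` for `t < 3/20`, `= 0` for
  `t > 3/10`, bounded on `t ≥ 0`), `qPert δ = q_δ` (smooth, `≥ 0`).
* §2 `levi_modelFun_qPert` — **the flat Levi form of `Ψ_{ε,δ} = modelFun g ε (qPert δ)`**:
  `L(u) = 4‖Dw u‖² + 4(Θ' + sΘ'')‖cx u‖² + ε (4‖cx u‖² + 4 δ μ(t) ‖cy u‖²)`
  (`s = ‖x‖²`, `t = ‖y‖²`, `μ = yMassLevi`), from `LefschetzBaseLevi.lean`.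
* §3 `exists_levi_modelFun_pos` — **strict plurisubharmonicity**: there is `δ₀ > 0` such that
  for `0 < δ ≤ δ₀` and `0 < ε ≤ 1` the Levi form is positive definite at every point of
  `{rho g ≤ 1/4} ⊇ {Ψ ≤ 1/4}`.  (Where `t < 3/20`: `μ = 1` and `L ≥ 4ε(‖a‖² + δ‖b‖²)`; where
  `t > 3/10`: `μ = 0` and `Dw u = 2 y b` if `a = 0`; in between `|μ| ≤ C`, `4t‖b‖² ≤
  2‖Dw u‖² + 2P²‖a‖²` with `P ≥ |p'(x)|` on the compact base, so the `δ`-term is absorbed for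
  `δ ≤ 3 / (20 (C+1)(P²+1))`.)
* §4 `exists_steinStructure_model` — **for such `δ, ε` (and `ε` below the threshold of the
  identification) the model `{Ψ ≤ 1/4}` is a compact regular sublevel set, diffeomorphic to
  `Base g` over a page-preserving diffeomorphism of `ℂ²`, and carries the Stein structure
  `(J₀|, Ψ|)`** (`exists_steinStructure_sublevel_of_levi_pos`).  The term `δ m(‖y‖²)` vanishes
  where `‖y‖² ≥ 3/10`, in particular near the binding `{w = 0} ∩ ∂`, where `Ψ = ‖w‖² + K(x)` is
  split — the form used by the Reeb-field computation of the base case.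

Relation to `LefschetzBaseSteinModel.lean` (the fact seat's concurrent file): that file's model
`Ω_g = {‖w‖² + ε‖x‖² + ε' ell(‖y‖²) ≤ 1/4}` (`ε = 1/1000`) is a different, larger strictly
pseudoconvex domain, whose identification with `Base g` is left there to sequels; the model of the
present file sits inside `{rho g ≤ 3/8}`, agrees with `Base g` where `‖x‖² < 4` up to the
`ε`-rounding, and COMES WITH its page-preserving identification `e : Base g ≅ {Ψ ≤ 1/4}`
(`exists_steinStructure_model`, from `LefschetzBaseModelIdentification.lean`).  Either model can
feed `palf_stein_supportedByBoundaryOpenBook_of_reebModels` once a Reeb field is produced; near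
the binding both potentials are split, `‖w‖² + K(x)`.

## References

* I. Torisu, *Convex contact structures and fibered links in 3-manifolds*, IMRN 2000:9, 441–454.
* S. Akbulut, B. Ozbagci, *Lefschetz fibrations on compact Stein surfaces*, Geom. Topol. 5 (2001),
  proof of Thm. 5. [AkbulutOzbagci2001]
* K. Cieliebak, Ya. Eliashberg, *From Stein to Weinstein and Back*, AMS Coll. Publ. 59 (2012),
  Ch. 2. [CieliebakEliashberg2012]
-/

noncomputable section

open scoped Manifold ContDiff Topology RealInnerProductSpace ComplexConjugate
open Set Function Complex Filter

namespace Literature.Geometry.Symplectic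

open Literature.Topology.FourManifolds Literature.Topology.FourManifolds.LefschetzBase

/-! ### §1 The perturbation `q_δ = ‖x‖² + δ m(‖y‖²)` -/

/-- `m(t) = χ(t) t` with `χ = yCutoff`: equal to `t` for `t ≤ 3/20`, to `0` for `t ≥ 3/10`.
[folklore] -/
def yMass (t : ℝ) : ℝ := yCutoff t * t

/-- `m` is smooth. [folklore] -/
theorem contDiff_yMass : ContDiff ℝ ∞ yMass := contDiff_yCutoff.mul contDiff_id

/-- `m(t) = t` for `t ≤ 3/20`. [folklore] -/
theorem yMass_of_le {t : ℝ} (ht : t ≤ 3 / 20) : yMass t = t := by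
  rw [yMass, yCutoff_of_le ht, one_mul]

/-- `m(t) = 0` for `t ≥ 3/10`. [folklore] -/
theorem yMass_of_ge {t : ℝ} (ht : 3 / 10 ≤ t) : yMass t = 0 := by
  rw [yMass, yCutoff_of_ge ht, zero_mul]

/-- `m ≥ 0` on `t ≥ 0`. [folklore] -/
theorem yMass_nonneg {t : ℝ} (ht : 0 ≤ t) : 0 ≤ yMass t := mul_nonneg (yCutoff_nonneg t) ht

/-- `m' = 1` on `t < 3/20`. [folklore] -/
theorem deriv_yMass_of_lt {t : ℝ} (ht : t < 3 / 20) : deriv yMass t = 1 := by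
  have hev : yMass =ᶠ[𝓝 t] id := by
    filter_upwards [Iio_mem_nhds ht] with s hs using yMass_of_le (le_of_lt hs)
  rw [hev.deriv_eq, deriv_id]

/-- `m' = 0` on `t > 3/10`. [folklore] -/
theorem deriv_yMass_of_gt {t : ℝ} (ht : 3 / 10 < t) : deriv yMass t = 0 := by
  have hev : yMass =ᶠ[𝓝 t] fun _ => (0 : ℝ) := by
    filter_upwards [Ioi_mem_nhds ht] with s hs using yMass_of_ge (le_of_lt hs)
  rw [hev.deriv_eq, deriv_const]

/-- `m'' = 0` on `t < 3/20`. [folklore] -/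
theorem deriv_deriv_yMass_of_lt {t : ℝ} (ht : t < 3 / 20) : deriv (deriv yMass) t = 0 := by
  have hev : deriv yMass =ᶠ[𝓝 t] fun _ => (1 : ℝ) := by
    filter_upwards [Iio_mem_nhds ht] with s hs using deriv_yMass_of_lt hs
  rw [hev.deriv_eq, deriv_const]

/-- `m'' = 0` on `t > 3/10`. [folklore] -/
theorem deriv_deriv_yMass_of_gt {t : ℝ} (ht : 3 / 10 < t) : deriv (deriv yMass) t = 0 := by
  have hev : deriv yMass =ᶠ[𝓝 t] fun _ => (0 : ℝ) := by
    filter_upwards [Ioi_mem_nhds ht] with s hs using deriv_yMass_of_gt hs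
  rw [hev.deriv_eq, deriv_const]

/-- **The Levi coefficient `μ(t) = m'(t) + t m''(t)` of `m(‖y‖²)`.** [folklore] -/
def yMassLevi (t : ℝ) : ℝ := deriv yMass t + t * deriv (deriv yMass) t

/-- `μ = 1` on `t < 3/20`. [folklore] -/
theorem yMassLevi_of_lt {t : ℝ} (ht : t < 3 / 20) : yMassLevi t = 1 := by
  rw [yMassLevi, deriv_yMass_of_lt ht, deriv_deriv_yMass_of_lt ht, mul_zero, add_zero]

/-- `μ = 0` on `t > 3/10`. [folklore] -/
theorem yMassLevi_of_gt {t : ℝ} (ht : 3 / 10 < t) : yMassLevi t = 0 := by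
  rw [yMassLevi, deriv_yMass_of_gt ht, deriv_deriv_yMass_of_gt ht, mul_zero, add_zero]

/-- `μ` is continuous. [folklore] -/
theorem continuous_yMassLevi : Continuous yMassLevi := by
  have h1 : ContDiff ℝ ∞ (deriv yMass) := contDiff_yMass.iterate_deriv 1
  have h2 : ContDiff ℝ ∞ (deriv (deriv yMass)) := contDiff_yMass.iterate_deriv 2
  exact h1.continuous.add (continuous_id.mul h2.continuous)

/-- `μ` is bounded on `t ≥ 0`. [folklore] -/
theorem exists_bound_yMassLevi : ∃ C : ℝ, 0 ≤ C ∧ ∀ t : ℝ, 0 ≤ t → |yMassLevi t| ≤ C := by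
  obtain ⟨C, hC⟩ := (isCompact_Icc : IsCompact (Icc (0 : ℝ) (3 / 10))).exists_bound_of_continuousOn
    continuous_yMassLevi.continuousOn
  refine ⟨max C 0, le_max_right _ _, fun t ht => ?_⟩
  rcases le_or_gt t (3 / 10) with h | h
  · have := hC t ⟨ht, h⟩
    rw [Real.norm_eq_abs] at this
    exact this.trans (le_max_left _ _)
  · rw [yMassLevi_of_gt h, abs_zero]
    exact le_max_right _ _

/-- **The perturbation `q_δ(z) = ‖x‖² + δ m(‖y‖²)`.** [folklore] -/
def qPert (δ : ℝ) (z : EuclideanSpace ℝ (Fin 4)) : ℝ := ‖cx z‖ ^ 2 + δ * yMass (‖cy z‖ ^ 2)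

/-- Unfolding. [folklore] -/
theorem qPert_apply (δ : ℝ) (z : EuclideanSpace ℝ (Fin 4)) :
    qPert δ z = ‖cx z‖ ^ 2 + δ * yMass (‖cy z‖ ^ 2) := rfl

/-- `q_δ` is smooth. [folklore] -/
theorem contDiff_qPert (δ : ℝ) : ContDiff ℝ ∞ (qPert δ) :=
  (contDiff_norm_sq_complex.comp contDiff_cx).add
    (contDiff_const.mul (contDiff_yMass.comp (contDiff_norm_sq_complex.comp contDiff_cy)))

/-- `q_δ ≥ 0` for `δ ≥ 0`. [folklore] -/
theorem qPert_nonneg {δ : ℝ} (hδ : 0 ≤ δ) (z : EuclideanSpace ℝ (Fin 4)) : 0 ≤ qPert δ z :=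
  add_nonneg (sq_nonneg _) (mul_nonneg hδ (yMass_nonneg (sq_nonneg _)))

/-- Near the binding (`‖y‖² ≥ 3/10`) the perturbation is `‖x‖²` only. [folklore] -/
theorem qPert_of_ge (δ : ℝ) {z : EuclideanSpace ℝ (Fin 4)} (hz : 3 / 10 ≤ ‖cy z‖ ^ 2) :
    qPert δ z = ‖cx z‖ ^ 2 := by
  rw [qPert, yMass_of_ge hz, mul_zero, add_zero]

/-! ### §2 The flat Levi form of the model function -/

/-- **The flat Levi form of `Ψ_{ε,δ} = ‖w‖² + Θ(‖x‖²) + ε (‖x‖² + δ m(‖y‖²))`**: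
`L(u) = 4‖Dw u‖² + 4(Θ'(s) + sΘ''(s))‖cx u‖² + ε (4‖cx u‖² + δ · 4 μ(t) ‖cy u‖²)`,
`s = ‖x‖²`, `t = ‖y‖²`. [cite: CieliebakEliashberg2012, Ch. 2] -/
theorem levi_modelFun_qPert (g : ℕ) (ε δ : ℝ) (z u : EuclideanSpace ℝ (Fin 4)) :
    fderiv ℝ (fderiv ℝ (modelFun g ε (qPert δ))) z u u +
        fderiv ℝ (fderiv ℝ (modelFun g ε (qPert δ))) z (stdComplexStructure u)
          (stdComplexStructure u) =
      4 * ‖fderiv ℝ (w g) z u‖ ^ 2 +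
        4 * (deriv convexProfile (‖cx z‖ ^ 2) +
          ‖cx z‖ ^ 2 * deriv (deriv convexProfile) (‖cx z‖ ^ 2)) * ‖cx u‖ ^ 2 +
        ε * (4 * ‖cx u‖ ^ 2 + δ * (4 * yMassLevi (‖cy z‖ ^ 2) * ‖cy u‖ ^ 2)) := by
  have hw2 : ContDiff ℝ 2 (fun y => ‖w g y‖ ^ 2) :=
    (contDiff_norm_sq_complex.comp (contDiff_w g)).of_le (by norm_cast)
  have hΘ2 : ContDiff ℝ 2 (fun y => convexProfile (‖cx y‖ ^ 2)) :=
    (contDiff_convexProfile.comp (contDiff_norm_sq_complex.comp contDiff_cx)).of_le (by norm_cast)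
  have hx2 : ContDiff ℝ 2 (fun y : EuclideanSpace ℝ (Fin 4) => ‖cx y‖ ^ 2) :=
    (contDiff_norm_sq_complex.comp contDiff_cx).of_le (by norm_cast)
  have hm2 : ContDiff ℝ 2 (fun y : EuclideanSpace ℝ (Fin 4) => yMass (‖cy y‖ ^ 2)) :=
    (contDiff_yMass.comp (contDiff_norm_sq_complex.comp contDiff_cy)).of_le (by norm_cast)
  have hδm2 : ContDiff ℝ 2 (fun y : EuclideanSpace ℝ (Fin 4) => δ * yMass (‖cy y‖ ^ 2)) :=
    contDiff_const.mul hm2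
  have hq2 : ContDiff ℝ 2 (qPert δ) := hx2.add hδm2
  have hεq2 : ContDiff ℝ 2 (fun y => ε * qPert δ y) := contDiff_const.mul hq2
  have h12 : ContDiff ℝ 2 (fun y => ‖w g y‖ ^ 2 + convexProfile (‖cx y‖ ^ 2)) := hw2.add hΘ2
  have hfun : modelFun g ε (qPert δ) =
      fun y => (‖w g y‖ ^ 2 + convexProfile (‖cx y‖ ^ 2)) + ε * qPert δ y := rfl
  have hqfun : qPert δ = fun y => ‖cx y‖ ^ 2 + δ * yMass (‖cy y‖ ^ 2) := rfl
  rw [hfun, leviFlat_add stdComplexStructure h12 hεq2, leviFlat_add stdComplexStructure hw2 hΘ2,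
    leviFlat_const_mul stdComplexStructure hq2, levi_norm_sq_w,
    levi_comp_norm_sq_cx (contDiff_convexProfile.of_le (by norm_cast)), hqfun,
    leviFlat_add stdComplexStructure hx2 hδm2, leviFlat_const_mul stdComplexStructure hm2,
    levi_norm_sq_cx, levi_comp_norm_sq_cy (contDiff_yMass.of_le (by norm_cast))]
  simp only [yMassLevi]

/-! ### §3 Strict plurisubharmonicity of the model function on the base -/

/-- A bound for `|p'(x)| = (2g+1)|x|^{2g}` on the compact `{rho g ≤ 1/4}`. [folklore] -/
theorem exists_bound_dP (g : ℕ) :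
    ∃ P : ℝ, 0 ≤ P ∧ ∀ z : EuclideanSpace ℝ (Fin 4), rho g z ≤ 1 / 4 → ‖dP g (cx z)‖ ≤ P := by
  obtain ⟨P, hP⟩ := (isCompact_rho_le g).exists_bound_of_continuousOn
    (contDiff_dP_cx g).continuous.continuousOn
  exact ⟨max P 0, le_max_right _ _, fun z hz => (hP z hz).trans (le_max_left _ _)⟩

/-- `Dw_z(u) = 2 cy(u) y - p'(x) cx(u)`. [folklore] -/
theorem fderiv_w_apply' (g : ℕ) (z u : EuclideanSpace ℝ (Fin 4)) :
    fderiv ℝ (w g) z u = 2 * cy u * cy z - dP g (cx z) * cx u := by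
  rw [fderiv_w_apply]; rfl

/-- **Strict plurisubharmonicity of `Ψ_{ε,δ}` on the base.**  There is `δ₀ > 0` such that for
`0 < δ ≤ δ₀` and `0 < ε ≤ 1` the flat Levi form of `modelFun g ε (qPert δ)` is positive definite
at every point of `{rho g ≤ 1/4}` (which contains the model `{Ψ ≤ 1/4}`, `rho_le_modelFun`).
[cite: CieliebakEliashberg2012, Ch. 2] -/
theorem exists_levi_modelFun_pos (g : ℕ) :
    ∃ δ₀ : ℝ, 0 < δ₀ ∧ ∀ δ : ℝ, 0 < δ → δ ≤ δ₀ → ∀ ε : ℝ, 0 < ε → ε ≤ 1 →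
      ∀ z : EuclideanSpace ℝ (Fin 4), rho g z ≤ 1 / 4 → ∀ u : EuclideanSpace ℝ (Fin 4), u ≠ 0 →
        0 < fderiv ℝ (fderiv ℝ (modelFun g ε (qPert δ))) z u u +
          fderiv ℝ (fderiv ℝ (modelFun g ε (qPert δ))) z (stdComplexStructure u)
            (stdComplexStructure u) := by
  obtain ⟨P, hP0, hP⟩ := exists_bound_dP g
  obtain ⟨C, hC0, hC⟩ := exists_bound_yMassLevi
  refine ⟨3 / (20 * (C + 1) * (P ^ 2 + 1)), by positivity, fun δ hδ hδ₀ ε hε hε1 z hz u hu => ?_⟩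
  rw [levi_modelFun_qPert]
  -- the quantities
  have hY : fderiv ℝ (w g) z u = 2 * cy u * cy z - dP g (cx z) * cx u := fderiv_w_apply' g z u
  have hT2 : 0 ≤ 4 * (deriv convexProfile (‖cx z‖ ^ 2) +
      ‖cx z‖ ^ 2 * deriv (deriv convexProfile) (‖cx z‖ ^ 2)) * ‖cx u‖ ^ 2 :=
    mul_nonneg (mul_nonneg (by norm_num) (levi_coeff_convexProfile_nonneg (sq_nonneg _)))
      (sq_nonneg _)
  have hNY := sq_nonneg ‖fderiv ℝ (w g) z u‖
  have hNA := sq_nonneg ‖cx u‖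
  have hNB := sq_nonneg ‖cy u‖
  -- `(cx u, cy u) ≠ 0`
  have hab : 0 < ‖cx u‖ ^ 2 + ‖cy u‖ ^ 2 := by
    by_contra hcon
    have ha0 : cx u = 0 := by
      have : ‖cx u‖ ^ 2 = 0 := by linarith
      exact norm_eq_zero.1 (pow_eq_zero_iff two_ne_zero |>.1 this)
    have hb0 : cy u = 0 := by
      have : ‖cy u‖ ^ 2 = 0 := by linarith
      exact norm_eq_zero.1 (pow_eq_zero_iff two_ne_zero |>.1 this)
    exact hu (LefschetzBaseSteinModel.eq_zero_of_cx_cy ha0 hb0)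
  -- `‖2 b y‖² = 4 t ‖b‖²`
  have h2by : ‖2 * cy u * cy z‖ ^ 2 = 4 * ‖cy z‖ ^ 2 * ‖cy u‖ ^ 2 := by
    rw [norm_mul, norm_mul, show ‖(2 : ℂ)‖ = 2 by norm_num]; ring
  have hεNA : 0 ≤ ε * ‖cx u‖ ^ 2 := mul_nonneg hε.le hNA
  rcases lt_or_ge (‖cy z‖ ^ 2) (3 / 20) with h1 | h1
  · -- far from `t ≥ 3/20`: `μ = 1`
    rw [yMassLevi_of_lt h1]
    have hlast : 0 < 4 * ‖cx u‖ ^ 2 + δ * (4 * 1 * ‖cy u‖ ^ 2) := by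
      by_cases hb : 0 < ‖cy u‖ ^ 2
      · linarith [mul_pos hδ hb]
      · have hb0 : ‖cy u‖ ^ 2 = 0 := le_antisymm (not_lt.1 hb) hNB
        rw [hb0]; linarith
    have := mul_pos hε hlast
    linarith
  rcases lt_or_ge (3 / 10) (‖cy z‖ ^ 2) with h2 | h2
  · -- `t > 3/10`: `μ = 0`
    rw [yMassLevi_of_gt h2]
    by_cases ha0 : cx u = 0
    · have hb2 : 0 < ‖cy u‖ ^ 2 := by
        rw [ha0, norm_zero] at hab; simpa using hab
      have hYn : ‖fderiv ℝ (w g) z u‖ ^ 2 = 4 * ‖cy z‖ ^ 2 * ‖cy u‖ ^ 2 := by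
        rw [hY, ha0, mul_zero, sub_zero, h2by]
      have ht0 : 0 < ‖cy z‖ ^ 2 := by linarith
      have : 0 < 4 * ‖cy z‖ ^ 2 * ‖cy u‖ ^ 2 := by positivity
      have h0 : ε * (4 * ‖cx u‖ ^ 2 + δ * (4 * 0 * ‖cy u‖ ^ 2)) = 4 * (ε * ‖cx u‖ ^ 2) := by
        ring
      rw [h0]
      linarith
    · have ha2 : 0 < ‖cx u‖ ^ 2 := pow_pos (norm_pos_iff.2 ha0) 2
      have : 0 < ε * (4 * ‖cx u‖ ^ 2 + δ * (4 * 0 * ‖cy u‖ ^ 2)) := by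
        apply mul_pos hε; linarith
      linarith
  · -- `3/20 ≤ t ≤ 3/10`: `|μ| ≤ C`, absorb the `δ`-term
    have hμ : |yMassLevi (‖cy z‖ ^ 2)| ≤ C := hC _ (sq_nonneg _)
    have hμl : -C ≤ yMassLevi (‖cy z‖ ^ 2) := (abs_le.1 hμ).1
    have hp : ‖dP g (cx z)‖ ≤ P := hP z hz
    -- (F1) `4 t ‖b‖² ≤ 2 ‖Y‖² + 2 P² ‖a‖²`
    have hF1 : 4 * ‖cy z‖ ^ 2 * ‖cy u‖ ^ 2 ≤
        2 * ‖fderiv ℝ (w g) z u‖ ^ 2 + 2 * P ^ 2 * ‖cx u‖ ^ 2 := by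
      have heq : 2 * cy u * cy z = fderiv ℝ (w g) z u + dP g (cx z) * cx u := by
        rw [hY]; ring
      have hle : ‖2 * cy u * cy z‖ ≤ ‖fderiv ℝ (w g) z u‖ + P * ‖cx u‖ := by
        rw [heq]
        refine (norm_add_le _ _).trans ?_
        rw [norm_mul]
        have := mul_le_mul_of_nonneg_right hp (norm_nonneg (cx u))
        linarith
      have h0 : 0 ≤ ‖2 * cy u * cy z‖ := norm_nonneg _
      have hsq : ‖2 * cy u * cy z‖ ^ 2 ≤ (‖fderiv ℝ (w g) z u‖ + P * ‖cx u‖) ^ 2 :=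
        pow_le_pow_left₀ h0 hle 2
      rw [h2by] at hsq
      nlinarith [sq_nonneg (‖fderiv ℝ (w g) z u‖ - P * ‖cx u‖), hsq]
    -- (F2) `3 ‖b‖² ≤ 10 ‖Y‖² + 10 P² ‖a‖²` (from `t ≥ 3/20`)
    have hF2 : 3 * ‖cy u‖ ^ 2 ≤ 10 * ‖fderiv ℝ (w g) z u‖ ^ 2 + 10 * P ^ 2 * ‖cx u‖ ^ 2 := by
      have := mul_le_mul_of_nonneg_right h1 hNB
      linarith
    -- the smallness of `δ`
    have hCP : 0 ≤ C * P ^ 2 := mul_nonneg hC0 (sq_nonneg P)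
    have hP2 : 0 ≤ P ^ 2 := sq_nonneg P
    have hδ1 : δ * ((C + 1) * (P ^ 2 + 1)) ≤ 3 / 20 := by
      have hpos : 0 < 20 * (C + 1) * (P ^ 2 + 1) := by positivity
      have := (le_div_iff₀ hpos).1 hδ₀
      linarith
    have hδC : δ * C ≤ 3 / 20 := by
      have : δ * C ≤ δ * ((C + 1) * (P ^ 2 + 1)) := by
        apply mul_le_mul_of_nonneg_left _ hδ.le; linarith
      linarith
    have hδCP : δ * C * P ^ 2 ≤ 3 / 20 := by
      have : δ * C * P ^ 2 ≤ δ * ((C + 1) * (P ^ 2 + 1)) := by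
        rw [mul_assoc]
        apply mul_le_mul_of_nonneg_left _ hδ.le; linarith
      linarith
    -- lower bound for the `δ`-term
    have hlow : -(4 * ε * δ * C * ‖cy u‖ ^ 2) ≤
        ε * (δ * (4 * yMassLevi (‖cy z‖ ^ 2) * ‖cy u‖ ^ 2)) := by
      have : 0 ≤ 4 * (ε * δ * ‖cy u‖ ^ 2) * (yMassLevi (‖cy z‖ ^ 2) + C) :=
        mul_nonneg (by positivity) (by linarith)
      linarith
    -- absorb: `4 ε δ C ‖b‖² ≤ 2 ε ‖Y‖² + 2 ε ‖a‖²`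
    have habs : 4 * ε * δ * C * ‖cy u‖ ^ 2 ≤
        2 * ε * ‖fderiv ℝ (w g) z u‖ ^ 2 + 2 * ε * ‖cx u‖ ^ 2 := by
      have h3 := mul_le_mul_of_nonneg_left hF2 (by positivity : 0 ≤ ε * δ * C)
      have h4 := mul_le_mul_of_nonneg_left hδC (by positivity : 0 ≤ ε * ‖fderiv ℝ (w g) z u‖ ^ 2)
      have h5 := mul_le_mul_of_nonneg_left hδCP (by positivity : 0 ≤ ε * ‖cx u‖ ^ 2)
      linarith
    have hεY : ε * ‖fderiv ℝ (w g) z u‖ ^ 2 ≤ ‖fderiv ℝ (w g) z u‖ ^ 2 := by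
      have := mul_le_mul_of_nonneg_right hε1 hNY; linarith
    -- the main terms do not both vanish
    have hmain : 0 < ‖fderiv ℝ (w g) z u‖ ^ 2 + ‖cx u‖ ^ 2 := by
      by_contra hcon
      have hY0 : fderiv ℝ (w g) z u = 0 := by
        have : ‖fderiv ℝ (w g) z u‖ ^ 2 = 0 := by linarith
        exact norm_eq_zero.1 (pow_eq_zero_iff two_ne_zero |>.1 this)
      have ha0 : cx u = 0 := by
        have : ‖cx u‖ ^ 2 = 0 := by linarith
        exact norm_eq_zero.1 (pow_eq_zero_iff two_ne_zero |>.1 this)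
      have hy0 : cy z ≠ 0 := by
        intro h0; rw [h0, norm_zero] at h1; norm_num at h1
      have hb0 : cy u = 0 := by
        have h2b : 2 * cy u * cy z = 0 := by
          have := hY
          rw [hY0, ha0, mul_zero, sub_zero] at this
          exact this.symm
        rcases mul_eq_zero.1 h2b with h | h
        · simpa using h
        · exact absurd h hy0
      rw [ha0, hb0, norm_zero] at hab; simp at hab
    have hmain' : 0 < ‖fderiv ℝ (w g) z u‖ ^ 2 + ε * ‖cx u‖ ^ 2 := by
      rcases lt_or_ge 0 (‖cx u‖ ^ 2) with h | h
      · linarith [mul_pos hε h]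
      · have h0 : ε * ‖cx u‖ ^ 2 = 0 := by rw [le_antisymm h hNA, mul_zero]
        have h0' : ‖cx u‖ ^ 2 = 0 := le_antisymm h hNA
        linarith
    linarith

/-! ### §4 The Stein structure on the model -/

/-- A point of the level `{Ψ = 1/4}`: `(x, y) = (0, √(3/2))`, where `w = 1/2`, `Θ(0) = 0`,
`m(3/2) = 0`. [folklore] -/
theorem exists_modelFun_qPert_eq (g : ℕ) (ε δ : ℝ) :
    ∃ z : EuclideanSpace ℝ (Fin 4), modelFun g ε (qPert δ) z = 1 / 4 := by
  refine ⟨mk 0 (Real.sqrt (3 / 2) : ℂ), ?_⟩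
  have hs : ((Real.sqrt (3 / 2) : ℂ)) ^ 2 = (3 / 2 : ℝ) := by
    rw [← Complex.ofReal_pow, Real.sq_sqrt (by norm_num)]
  have hw : w g (mk 0 (Real.sqrt (3 / 2) : ℂ)) = (1 / 2 : ℝ) := by
    simp only [w, Phi, cx_mk, cy_mk, hs, zero_pow (Nat.succ_ne_zero _)]
    push_cast; ring
  have hy : ‖cy (mk 0 (Real.sqrt (3 / 2) : ℂ))‖ ^ 2 = 3 / 2 := by
    rw [cy_mk, Complex.norm_real, Real.norm_eq_abs, sq_abs, Real.sq_sqrt (by norm_num)]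
  rw [modelFun_apply, qPert_apply, hw, hy, cx_mk, norm_zero, yMass_of_ge (by norm_num),
    Complex.norm_real]
  simp [convexProfile_of_le_four]
  norm_num

/-- **The rounded convex model of the base is a Stein domain.**  For every genus `g` there are
`δ > 0` and `ε > 0` such that `Ψ = modelFun g ε (qPert δ)` has regular value `1/4` with compact
sublevel set `{Ψ ≤ 1/4}`, the base `Base g` is diffeomorphic to `{Ψ ≤ 1/4}` over a
diffeomorphism `Φ` of `ℂ²` carrying `{rho ≤ 1/4}`, `{rho = 1/4}` onto `{Ψ ≤ 1/4}`, `{Ψ = 1/4}`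
with `w ∘ Φ = r · w`, `r > 0` (pages and binding preserved), the flat Levi form of `Ψ` is
positive definite on `{rho ≤ 1/4}`, and `{Ψ ≤ 1/4}` carries the Stein structure `(J₀|, Ψ|)`
(`J₀ = stdComplexStructure`) — Torisu's / Akbulut–Ozbagci's Stein `F × D²`, as an explicit
sublevel set of `ℂ²`. [cite: AkbulutOzbagci2001, Thm. 5] -/
theorem exists_steinStructure_model (g : ℕ) :
    ∃ δ : ℝ, 0 < δ ∧ ∃ ε : ℝ, 0 < ε ∧
      ∃ (hΨ : IsRegularLevel (𝓡 4) (modelFun g ε (qPert δ)) (1 / 4))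
        (_ : CompactSpace (RegularSublevel hΨ))
        (Φ : EuclideanSpace ℝ (Fin 4) ≃ₘ⟮𝓘(ℝ, EuclideanSpace ℝ (Fin 4)),
          𝓘(ℝ, EuclideanSpace ℝ (Fin 4))⟯ EuclideanSpace ℝ (Fin 4))
        (e : Base g ≃ₘ⟮𝓡∂ 4, 𝓡∂ 4⟯ RegularSublevel hΨ)
        (S : SteinStructure (RegularSublevel hΨ)),
        (∀ p, RegularSublevel.incl hΨ (e p) = Φ (RegularSublevel.incl (isRegularLevel_rho g) p)) ∧
        Φ '' (rho g ⁻¹' Iic (1 / 4)) = modelFun g ε (qPert δ) ⁻¹' Iic (1 / 4) ∧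
        Φ '' (rho g ⁻¹' {1 / 4}) = modelFun g ε (qPert δ) ⁻¹' {1 / 4} ∧
        (∀ z, ∃ r : ℝ, 0 < r ∧ w g (Φ z) = (r : ℂ) * w g z) ∧
        (∀ z, rho g z ≤ 1 / 4 → ∀ u : EuclideanSpace ℝ (Fin 4), u ≠ 0 →
          0 < fderiv ℝ (fderiv ℝ (modelFun g ε (qPert δ))) z u u +
            fderiv ℝ (fderiv ℝ (modelFun g ε (qPert δ))) z (stdComplexStructure u)
              (stdComplexStructure u)) ∧
        S.φ = sublevelPhi hΨ ∧ S.J = sublevelJ hΨ stdComplexStructure := by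
  obtain ⟨δ₀, hδ₀, Hpsh⟩ := exists_levi_modelFun_pos g
  obtain ⟨ε₀, hε₀, Hid⟩ := exists_model_diffeomorph g (contDiff_qPert δ₀) (qPert_nonneg hδ₀.le)
  set ε := min ε₀ 1 with hεdef
  have hε : 0 < ε := lt_min hε₀ one_pos
  obtain ⟨hΨ, Φ, e, he, hle, heq, hw⟩ := Hid ε hε.le (min_le_left _ _)
  have hpsh := Hpsh δ₀ hδ₀ le_rfl ε hε (min_le_right _ _)
  haveI : CompactSpace (RegularSublevel hΨ) := isCompact_iff_compactSpace.1
    (isCompact_modelFun_le g hε.le (contDiff_qPert δ₀) (qPert_nonneg hδ₀.le))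
  obtain ⟨S, hSφ, hSJ⟩ := exists_steinStructure_sublevel_of_levi_pos hΨ stdComplexStructure
    stdComplexStructure_sq (exists_modelFun_qPert_eq g ε δ₀)
    (fun z hz u hu => hpsh z ((rho_le_modelFun g hε.le (qPert_nonneg hδ₀.le) z).trans hz) u hu)
  exact ⟨δ₀, hδ₀, ε, hε, hΨ, inferInstance, Φ, e, S, he, hle, heq, hw, hpsh, hSφ, hSJ⟩

end Literature.Geometry.Symplectic

end
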